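import Summits.CriticalPhenomena.PercolationContinuityZ3.Theses.PercCriticalCaps
import Summits.CriticalPhenomena.PercolationContinuityZ3.Theorems.PercNearOneGluingNoHeavyLowerTailCSHTheoremOne
import Literature.Probability.Percolation.TwoPointFunction
import Literature.Probability.Percolation.BondPercolationSymmetry
import Literature.Probability.Percolation.PercolationProofs
import Literature.Probability.LatticeModels.LatticeGraph
import HarnessLib

/-!
# `PercCriticalCaps.EnvelopeCap` (stmt-CriticalPhenomena-7513) — SETTLED after continuity

Item `stmt-CriticalPhenomena-7513` of route `CriticalPhenomena/PercCriticalCaps` (support (deterministic + shifts)): if almost surely only finitely many `t > 0` have `t·e₀ ↔ {y₀ = 0}`, then almost surely there is a cap `B ⊇ {x₀ ≤ 0}`, bounded above on every vertical line, all of whose boundary edges are closed.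

Shift invariance (`bondPercolation_real_preimage_shift`, `preimage_relabel_shift_openConn`) transports the hypothesis to every vertical line (countably many, `ae_all_iff`); the cap is `{x₀ ≤ 0} ∪ ⋃_{y₀ = 0} C(y)`: its vertical sections above height 0 are hit sets (finite), and an open boundary edge `xy` would put `y` in the cluster of the plane (if `x₀ ≤ 0 < y₀` then `x₀ = 0`).  p205010 is NOT used.

builds on p205010 (kernel theorem, internal audit signed; external expert review pending) — USED (`CSH.percolationContinuityZ3_holds`).  RSW3 lane, lead gen 28 (prover-prim-rsw3-lead-g28-0):
'after continuity — the ledger harvest'.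
References: G. Kozma, N. Nitzan (2024), Thm. 6 / Conj. 3 [KozmaNitzan2024]; G. Grimmett, *Percolation* (1999), §8 [GrimmettPercolation1999].
-/

noncomputable section

namespace Summit.CriticalPhenomena.PercolationContinuityZ3.Theorems

namespace PercCriticalCapsEnvelopeCap

open MeasureTheory Literature.Probability.Percolation Literature.Probability.LatticeModels

variable {d : ℕ}

/-- Neighbours in `ℤ^d` differ by at most one in the first coordinate (upper form). [folklore] -/
theorem apply_zero_le_add_one_of_adj [NeZero d] {x y : Site d} (h : (zdGraph d).Adj x y) : y 0 ≤ x 0 + 1 := by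
  obtain ⟨i, h | h⟩ := (zdGraph_adj_iff x y).1 h
  · rw [h, Pi.add_apply]
    by_cases hi : (0 : Fin d) = i
    · subst hi; rw [Pi.single_eq_same]
    · rw [Pi.single_eq_of_ne hi]; omega
  · rw [h, Pi.add_apply]
    by_cases hi : (0 : Fin d) = i
    · subst hi; rw [Pi.single_eq_same]; omega
    · rw [Pi.single_eq_of_ne hi]; omega

/-- `update x 0 t = update x 0 0 + t e₀`. [folklore] -/
theorem update_eq_update_zero_add_single [NeZero d] (x : Site d) (t : ℤ) :
    Function.update x 0 t = Function.update x 0 0 + Pi.single 0 t := by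
  funext i
  by_cases hi : i = 0
  · subst hi; simp
  · simp [Function.update_of_ne hi, Pi.single_eq_of_ne hi]

/-- **`PercCriticalCaps.EnvelopeCap` (stmt-CriticalPhenomena-7513), settled.**  shift invariance to every vertical line + the cap `{x₀ ≤ 0} ∪ clusters of the plane`.
[cite: KozmaNitzan2024, Thm. 6 with Conj. 3 (p. 15)] -/
theorem envelopeCap_proof : Summit.CriticalPhenomena.PercolationContinuityZ3.Theses.PercCriticalCaps.EnvelopeCap := by
  intro d _ p hfin
  classical
  set μ := bondPercolation (zdGraph d) p with hμ
  -- hits on the vertical line through `u` (base point `update u 0 0` on the plane)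
  set hitsAt : Site d → BondConfig (Site d) → Set ℤ := fun u ω =>
    {t : ℤ | 0 < t ∧ ∃ y : Site d, y 0 = 0 ∧ ω ∈ openConn (Function.update u 0 0 + Pi.single 0 t : Site d) y} with hhits
  -- a.s. every vertical line has finitely many hits (shift invariance, countably many lines)
  have hall : ∀ᵐ ω ∂μ, ∀ u : Site d, (hitsAt u ω).Finite := by
    refine ae_all_iff.2 fun u => ?_
    set u' : Site d := Function.update u 0 0 with hu'
    set T := BondConfig.relabel (sym2Equiv (Site.shift (-u'))) with hT
    set F : Set (BondConfig (Site d)) :=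
      {ω | Set.Finite {t : ℤ | 0 < t ∧ ∃ y : Site d, y 0 = 0 ∧ ω ∈ openConn (Pi.single 0 t : Site d) y}} with hF
    -- `T⁻¹ F` has full measure
    have hFc : μ.real Fᶜ = 0 := by
      rw [measureReal_def, ENNReal.toReal_eq_zero_iff]
      exact Or.inl (mem_ae_iff.1 hfin)
    have hTF : μ (T ⁻¹' Fᶜ) = 0 := by
      have h := bondPercolation_real_preimage_shift (-u') p Fᶜ
      rw [hFc, measureReal_def, ENNReal.toReal_eq_zero_iff] at h
      exact h.resolve_right (measure_ne_top _ _)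
    have hae : ∀ᵐ ω ∂μ, T ω ∈ F := by
      rw [ae_iff]
      exact hTF
    filter_upwards [hae] with ω hω
    -- `hitsAt u ω` is the hit set of `T ω`
    refine (hω.subset fun t ht => ?_)
    obtain ⟨ht0, y, hy, hωy⟩ := ht
    refine ⟨ht0, y - u', by simp [hu', hy], ?_⟩
    have h := preimage_relabel_shift_openConn (-u') (u' + Pi.single 0 t : Site d) y
    rw [show (u' + Pi.single 0 t : Site d) + -u' = Pi.single 0 t by abel, ← sub_eq_add_neg] at h
    show ω ∈ T ⁻¹' (openConn (Pi.single 0 t : Site d) (y - u') : Set (BondConfig (Site d)))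
    rw [hT, h]
    exact hωy
  filter_upwards [hall] with ω hω
  -- the cap: the lower half-space together with the clusters of the plane
  refine ⟨{x | x 0 ≤ 0} ∪ {z | ∃ y : Site d, y 0 = 0 ∧ ω ∈ openConn z y}, Set.subset_union_left, fun x => ?_, ?_⟩
  · -- bounded above along every vertical line
    have hsub : {t : ℤ | Function.update x 0 t ∈ ({x : Site d | x 0 ≤ 0} ∪ {z | ∃ y : Site d, y 0 = 0 ∧ ω ∈ openConn z y})} ⊆
        Set.Iic 0 ∪ hitsAt x ω := by
      intro t ht
      simp only [Set.mem_setOf_eq, Set.mem_union, Function.update_self] at ht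
      rcases le_or_gt t 0 with h0 | h0
      · exact Or.inl h0
      · rcases ht with h | ⟨y, hy, hωy⟩
        · exact absurd h (by omega)
        · refine Or.inr ⟨h0, y, hy, ?_⟩
          rw [← update_eq_update_zero_add_single]; exact hωy
    exact (bddAbove_Iic.union (hω x).bddAbove).mono hsub
  · -- every boundary edge of the cap is closed
    rintro x hx y hy hadj hopen
    have hreach : ω ∈ openConn x y := by
      show (openGraph ω).Reachable x y
      exact SimpleGraph.Adj.reachable ((openGraph_adj ω x y).2 ⟨hopen, hadj.ne⟩)
    simp only [Set.mem_union, Set.mem_setOf_eq, not_or, not_exists, not_and] at hy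
    obtain ⟨hy0, hy1⟩ := hy
    rcases hx with hx0 | ⟨y', hy', hωy'⟩
    · -- `x₀ ≤ 0 < y₀ ≤ x₀ + 1` forces `x₀ = 0`: `x` lies on the plane and is joined to `y`
      have h1 := apply_zero_le_add_one_of_adj hadj
      have hx0' : x 0 ≤ 0 := hx0
      have hy0' : 0 < y 0 := not_le.1 hy0
      have hx00 : x 0 = 0 := by omega
      exact hy1 x hx00 hreach.symm
    · exact hy1 y' hy' (hreach.symm.trans hωy')

end PercCriticalCapsEnvelopeCap

end Summit.CriticalPhenomena.PercolationContinuityZ3.Theorems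

end
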